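import Summits.HodgeConjecture.HodgeConjecture.Theorems.K2E1KTypeCharacterArchLevelU      -- ★ p860912 (K2E1-p12 g3): `Kad = closure(ι_∞κ(K) ∪ ι_f(K′_f))`, `exists_kTypeCharacter` (the `ω̃`), `forall_apply_eq_smul_iff`
import Summits.HodgeConjecture.HodgeConjecture.Theorems.R90S8CompactAbelianIsotypicDense    -- ★ p862144 (K2E1-p15 g3): (D-arch) head `iSup_iInf_eigenspace_topologicalClosure_eq_top` (Peter–Weyl, compact abelian, Hilbert)
import Literature.NumberTheory.Automorphic.DiscreteAutomorphicRepFinAdelicScalar            -- ★ (D-fin) `DiscreteAutomorphicRep.dense_finRep_smoothPart`; brings `finRep`, `smoothPart`, `rightRegular`, `ClosedSubrep`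
import Literature.NumberTheory.Automorphic.AutomorphicSpectrumProofs                        -- ★ `AdelicGroupData.isStronglyContinuous_rightRegular_holds`
import Literature.NumberTheory.Automorphic.UnramifiedHeckeScalarsFlathProofs                -- ★ `ClosedSubrep.isUnitary_toContRep`
import HarnessLib

/-!
# R90-TF · S8 «ContSpec-n½» — `R90S8IsotypicDensityOfLettersU2`: THE DENSITY LETTER (D) OF THE #4′ ASSEMBLY, PAID FROM (D-fin) ★ AND (D-arch) ★
# — `P ≤ closure ⨆_{(K′_f, χ, ω̃)} P ∩ Iso(Kad(K′_f), ω̃)` for an irreducible closed `P ≤ L²`, over the STANDARD levels `Kad(K′_f) = closure(ι_∞κ(K) ∪ ι_f(K′_f))`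

Cell `hodgecm-mathlib`, crux H413 (`stmt-HodgeConjecture-24833`, lane `--supports … --as helper`), route of record `HCCMUnconditional`; R90-TF section S8 (R90-CS-plan (g2) S8-R19∕R22;
K2E1-p15 (g3)'s ask 2026-09-04T16:45:39Z «take (D-glue)+(D-fin)»; consumer: the letter `hD` of ★ p862113 `R90S8ResHLeClosureCharLinesOfLetters.residual_le_topologicalClosure_iSup_charLines_of_letters`,
whose index type `ι`, levels `K' : ι → Subgroup G(𝔸)` and characters `ω : ∀ ℓ, ↥(K' ℓ) →* ℂ` are the CONSUMER's choice).  THEOREMS ONLY (no `def`, no `instance`, no notation, no named-fact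
hypothesis, no letter left, no `sorry`; default heartbeats); count-neutral.  Generic `F, E, c, N, J` (the consumer is `quasiSplit L⁺ L c 2 = adelicGroupData L⁺ L c 2 ((antidiagonal 2).over L)`,
`rfl`) and a generic compact abelian `K` read in `G(F ⊗ ℝ)` by an injective continuous `κ` (the consumer's `K_∞`).

THE MATHEMATICS ([BorelJacquet1979, §4.1, §4.6]; [Knapp1986, VIII §3]; [BrockerTomDieck1985, III (5.7)]; [MoeglinWaldspurger1995, I.2.18]).  `P` an irreducible closed subrepresentation of
`L²(G(F)\G(𝔸_F))` for `G = U(J)`; `K` a compact abelian group read in `G(F ⊗ ℝ)` by an injective continuous `κ`; `K₀ ≤ G(𝔸_{F,f})` an OPEN subgroup (the integral level `K_{max,f}`, so that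
the standard levels `Kad(K′_f)`, `K′_f ≤ K₀` open, carry the estate's `hdo ∕ hHK′ ∕ hW` letters).  The INDEX FAMILY is `Λ := Σ (K′_f ≤ K₀ open) (χ ∈ K̂) {ω̃ : ↥Kad(K′_f) →* ℂ ∣ ω̃(ι_∞κk) = χ k,
ω̃(ι_f u) = 1}` (every `(K′_f, χ)` has such an `ω̃`, ★ `exists_kTypeCharacter`), with `K' ℓ := Kad(K′_f)` and `ω ℓ := ω̃` — exactly the `(Kad, ω)` currency of the ★ `…KTypeU2` files.
* (D-fin) ★ `DiscreteAutomorphicRep.dense_finRep_smoothPart`: the `G(𝔸_{F,f})`-smooth vectors are dense in `P`; a smooth vector `s` is fixed by the open `K′_f := Stab(s) ∩ K₀ ≤ K₀`, so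
  `P ≤ closure ⨆_{K′_f} (P ∩ Fix K′_f)` (§3).
* (D-arch) ★ `iSup_iInf_eigenspace_topologicalClosure_eq_top` (K2E1-p15): for a unitary strongly continuous representation of the compact abelian `K` on a Hilbert space the joint eigenspaces
  `H_χ`, `χ ∈ K̂`, span a dense subspace.  Applied (§2, §4) to the restriction of `R ∘ ι_∞ ∘ κ` to the CLOSED `K`-STABLE subspace `P ∩ Fix K′_f` (`ι_∞(K)` and `ι_f(K′_f)` commute, ★
  `commute_archToAdelic_finAdelicToAdelic`; `R` unitary ★ `isUnitary_rightRegular`, strongly continuous ★ `isStronglyContinuous_rightRegular_holds`): `P ∩ Fix K′_f ≤ closure ⨆_χ (P ∩ Fix K′_f ∩ Eig χ)`.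
* `P ∩ Fix K′_f ∩ Eig χ ≤ P ∩ Iso(Kad(K′_f), ω̃)` by ★ `forall_apply_eq_smul_iff` (joint eigenvectors of `ι_∞κ(K)` and `ι_f(K′_f)` are eigenvectors of the closure of the group they generate) (§5).
Two closure steps compose (§1, generic lattice lemma), giving `hD` in the print's EXACT bytes (`Iso ℓ = ⨅ k : ↥(K' ℓ), eigenspace (R ((K' ℓ).subtype k)) (ω ℓ k)`) (§6).
* §1 `le_topologicalClosure_iSup_sigma_of_two_steps` — generic: `P ≤ cl ⨆_a S a`, `S a ≤ cl ⨆_b T a b`, `∃ w, T a b ≤ Q a b w` ⟹ `P ≤ cl ⨆_{(a,b,w)} Q a b w`.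
* §2 `le_topologicalClosure_iSup_inf_iInf_eigenspace_of_invariant` — generic Hilbert: (D-arch) ★ transported to a closed invariant subspace `W` (the sub-representation `W.toContRep`).
* §3 **`le_topologicalClosure_iSup_inf_fix`** — (D-fin) in submodule form: `P ≤ cl ⨆_{K′_f ≤ K₀ open} (P ⊓ Fix K′_f)` (★ `dense_finRep_smoothPart`).
* §4 **`inf_fix_le_topologicalClosure_iSup_inf_eig`** — (D-arch) at `U(J)`: `P ⊓ Fix K′_f ≤ cl ⨆_{χ ∈ K̂} (P ⊓ Fix K′_f ⊓ Eig χ)`.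
* §5 `inf_fix_inf_eig_le_iso`, `exists_kTypeCharacter_inf_fix_inf_eig_le_iso` — `P ⊓ Fix K′_f ⊓ Eig τ ≤ P ⊓ Iso(Kad(K′_f), ω̃)` for an `ω̃` with the generator equations.
* §6 **`le_topologicalClosure_iSup_inf_iso`** — THE (D) LETTER `hD` over `Λ`, no letter left.
HONEST LABEL: HC_CM is proved only modulo the 7 printed citations (2 remaining named inputs: hLiu418 = `stmt-HodgeConjecture-24832`, h413 = `stmt-HodgeConjecture-24833`) until rung 0
closes; count-neutral helper; closes no socket.

## References
* [BorelJacquet1979] A. Borel, H. Jacquet, *Automorphic forms and automorphic representations*, PSPM 33.1 (1979), §4.1 (`K_∞·K_f`-types), §4.6 (admissibility, smooth vectors).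
* [Knapp1986] A. W. Knapp, *Representation Theory of Semisimple Groups* (1986), VIII §3 (`K`-types).
* [BrockerTomDieck1985] T. Bröcker, T. tom Dieck, *Representations of Compact Lie Groups* (1985), III (5.7) (isotypic decomposition of a Hilbert representation of a compact group).
* [MoeglinWaldspurger1995] C. Mœglin, J.-L. Waldspurger, *Spectral Decomposition and Eisenstein Series* (1995), I.2.18.
-/

set_option autoImplicit false
set_option linter.dupNamespace false

noncomputable section

open Set Filter Topology NumberField IsDedekindDomain MeasureTheory
open Literature.NumberTheory.Automorphic Literature.NumberTheory.Automorphic.UnitaryGroup AdelicGroupData ContRepresentation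
open Summit.HodgeConjecture.HodgeConjecture.Cruxes.H413.K2E1KTypeCharacterArchLevelU (exists_kTypeCharacter forall_apply_eq_smul_iff)

namespace Summit.HodgeConjecture.HodgeConjecture.R90.S8

/-! ## §1 Generic: two closure steps compose (`Σ`-indexed) -/

section Lattice

variable {𝕜 M : Type*} [Semiring 𝕜] [AddCommMonoid M] [Module 𝕜 M] [TopologicalSpace M] [ContinuousAdd M] [ContinuousConstSMul 𝕜 M]

/-- **TWO CLOSURE STEPS COMPOSE**: `P ≤ cl ⨆_a S a`, `S a ≤ cl ⨆_b T a b` for every `a`, and every `T a b` lies below `Q a b w` for some witness `w : γ a b` ⟹ `P ≤ cl ⨆_{ℓ = (a, b, w)} Q a b w`.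
[cite: MoeglinWaldspurger1995, I.2.18] -/
theorem le_topologicalClosure_iSup_sigma_of_two_steps {α : Type*} {β : α → Type*} {γ : ∀ a, β a → Type*} (P : Submodule 𝕜 M) (S : α → Submodule 𝕜 M)
    (T : ∀ a, β a → Submodule 𝕜 M) (Q : ∀ a (b : β a), γ a b → Submodule 𝕜 M) (h1 : P ≤ (⨆ a, S a).topologicalClosure)
    (h2 : ∀ a, S a ≤ (⨆ b, T a b).topologicalClosure) (h3 : ∀ a b, ∃ w : γ a b, T a b ≤ Q a b w) :
    P ≤ (⨆ ℓ : (Σ a, Σ b : β a, γ a b), Q ℓ.1 ℓ.2.1 ℓ.2.2).topologicalClosure := by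
  refine h1.trans ((Submodule.topologicalClosure_minimal _ (iSup_le fun a => (h2 a).trans ?_) (Submodule.isClosed_topologicalClosure _)))
  refine Submodule.topologicalClosure_mono (iSup_le fun b => ?_)
  obtain ⟨w, hw⟩ := h3 a b
  exact hw.trans (le_iSup (fun ℓ : (Σ a, Σ b : β a, γ a b) => Q ℓ.1 ℓ.2.1 ℓ.2.2) ⟨a, b, w⟩)

end Lattice

/-! ## §2 Generic Hilbert: (D-arch) ★ on a closed invariant subspace -/

section Hilbert

variable {C : Type*} [CommGroup C] [TopologicalSpace C] [IsTopologicalGroup C] [CompactSpace C] [T2Space C]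
  {H : Type*} [NormedAddCommGroup H] [InnerProductSpace ℂ H] [CompleteSpace H]

/-- **ISOTYPIC DENSITY ON A CLOSED INVARIANT SUBSPACE**: for `σ` a unitary strongly continuous representation of the compact abelian `C` on the Hilbert space `H` and `W ≤ H` a CLOSED
`σ`-STABLE subspace, `W ≤ closure ⨆_{χ ∈ Ĉ} (W ⊓ H_χ)`, `H_χ = ⨅_c ker(σ(c) − χ(c))` — ★ `iSup_iInf_eigenspace_topologicalClosure_eq_top` (with the Borel σ-algebra and the Haar
probability measure of `C`, Mathlib `haarMeasure ⊤`) for the sub-representation `W.toContRep` (unitary ★ `ClosedSubrep.isUnitary_toContRep`, strongly continuous by the induced topology), pushed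
through the continuous inclusion `↥W → H`. [cite: BrockerTomDieck1985, III (5.7)] -/
theorem le_topologicalClosure_iSup_inf_iInf_eigenspace_of_invariant {σ : ContRepresentation ℂ C H} (hσ : σ.IsUnitary) (hsc : σ.IsStronglyContinuous)
    (W : Submodule ℂ H) (hWc : IsClosed (W : Set H)) (hWinv : ∀ (c : C), ∀ v ∈ W, σ c v ∈ W) :
    W ≤ (⨆ χ : PontryaginDual C, W ⊓ ⨅ c : C, Module.End.eigenspace ((σ c : H →L[ℂ] H) : H →ₗ[ℂ] H) ((χ c : Circle) : ℂ)).topologicalClosure := by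
  -- Borel σ-algebra and Haar probability measure on the compact group `C`
  letI : MeasurableSpace C := borel C
  haveI : BorelSpace C := ⟨rfl⟩
  haveI : IsProbabilityMeasure (Measure.haarMeasure (⊤ : TopologicalSpace.PositiveCompacts C)) :=
    ⟨by rw [← TopologicalSpace.PositiveCompacts.coe_top]; exact Measure.haarMeasure_self⟩
  -- `W` as a closed subrepresentation of `σ`; the restricted representation on the Hilbert space `↥W` is unitary and strongly continuous
  let W' : ClosedSubrep σ := { toSubmodule := W, apply_mem_toSubmodule := fun c v hv => hWinv c v hv, isClosed' := hWc }
  have hρ : W'.toContRep.IsUnitary := ClosedSubrep.isUnitary_toContRep hσ W'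
  have hρsc : W'.toContRep.IsStronglyContinuous := fun v => by
    refine continuous_induced_rng.2 ?_
    have h : (Subtype.val ∘ fun c : C => W'.toContRep c v) = fun c : C => σ c (v : H) := by
      funext c
      rfl
    rw [h]
    exact hsc (v : H)
  have htop := iSup_iInf_eigenspace_topologicalClosure_eq_top (Measure.haarMeasure (⊤ : TopologicalSpace.PositiveCompacts C)) hρ hρsc
  -- the image of the dense subspace of `↥W` under the inclusion lies in `⨆_χ (W ⊓ H_χ)`
  have hmap : Submodule.map W'.toSubmodule.subtype
        (⨆ χ : PontryaginDual C, ⨅ c : C, Module.End.eigenspace ((W'.toContRep c : W'.toSubmodule →L[ℂ] W'.toSubmodule) : W'.toSubmodule →ₗ[ℂ] W'.toSubmodule) ((χ c : Circle) : ℂ)) ≤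
      ⨆ χ : PontryaginDual C, W ⊓ ⨅ c : C, Module.End.eigenspace ((σ c : H →L[ℂ] H) : H →ₗ[ℂ] H) ((χ c : Circle) : ℂ) := by
    rw [Submodule.map_iSup]
    refine iSup_mono fun χ => ?_
    rintro _ ⟨y, hy', rfl⟩
    refine Submodule.mem_inf.2 ⟨y.2, (Submodule.mem_iInf _).2 fun c => Module.End.mem_eigenspace_iff.2 ?_⟩
    have h := Module.End.mem_eigenspace_iff.1 ((Submodule.mem_iInf _).1 (SetLike.mem_coe.1 hy') c)
    exact congrArg Subtype.val h
  -- push the density through the (continuous) inclusion `↥W → H`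
  intro v hv
  have hy := htop.ge (Submodule.mem_top (x := (⟨v, hv⟩ : W'.toSubmodule)))
  rw [← SetLike.mem_coe, Submodule.topologicalClosure_coe] at hy
  have himg := image_closure_subset_closure_image continuous_subtype_val (mem_image_of_mem Subtype.val hy)
  rw [← SetLike.mem_coe, Submodule.topologicalClosure_coe]
  refine closure_mono ?_ himg
  rintro _ ⟨y, hyS, rfl⟩
  exact hmap (Submodule.mem_map_of_mem hyS)

end Hilbert

section Adelic

variable {F E : Type} [Field F] [NumberField F] [Field E] [NumberField E] [Algebra F E] {c : E ≃ₐ[F] E} {N : ℕ} {J : Matrix (Fin N) (Fin N) E}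
variable (μ : Measure (adelicGroupData F E c N J).automorphicQuotient) [(adelicGroupData F E c N J).IsAutomorphicMeasure μ]

/-! ## §3 (D-fin): `P ≤ closure ⨆_{K′_f ≤ K₀ open} (P ⊓ Fix K′_f)` -/

/-- **(D-fin) IN SUBMODULE FORM**: for an irreducible closed `P ≤ L²(G(F)\G(𝔸_F))` and an OPEN `K₀ ≤ G(𝔸_{F,f})`, `P ≤ closure ⨆_{K′_f ≤ K₀, K′_f open} (P ⊓ Fix(ι_f K′_f))` — every
`G(𝔸_{F,f})`-smooth vector `s ∈ P` (open stabiliser, ★ `smoothPart`) is fixed by the open `K′_f := Stab(s) ⊓ K₀`, and the smooth vectors are dense (★ `dense_finRep_smoothPart`).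
[cite: BorelJacquet1979, §4.6] -/
theorem le_topologicalClosure_iSup_inf_fix (P : ClosedSubrep ((adelicGroupData F E c N J).rightRegular μ)) (hP : P.toContRep.IsTopIrreducible)
    (K₀ : Subgroup (finAdelic F E c N J)) (hK₀ : IsOpen (K₀ : Set (finAdelic F E c N J))) :
    P.toSubmodule ≤ (⨆ Kf : {Kf : Subgroup (finAdelic F E c N J) // IsOpen (Kf : Set (finAdelic F E c N J)) ∧ Kf ≤ K₀},
      P.toSubmodule ⊓ ⨅ u : ↥Kf.1, Module.End.eigenspace ((((adelicGroupData F E c N J).rightRegular μ) (finAdelicToAdelic F E c N J (u : finAdelic F E c N J)) :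
        (adelicGroupData F E c N J).L2 μ →L[ℂ] (adelicGroupData F E c N J).L2 μ) : (adelicGroupData F E c N J).L2 μ →ₗ[ℂ] (adelicGroupData F E c N J).L2 μ) 1).topologicalClosure := by
  set D : DiscreteAutomorphicRep (adelicGroupData F E c N J) μ := ⟨P, hP⟩ with hD
  intro v hv
  -- the smooth vectors of `P` are dense; push through the (continuous) inclusion `P ↪ L²`
  have hvcl : v ∈ closure ((fun w : ↥P.toSubmodule => (w : (adelicGroupData F E c N J).L2 μ)) '' (D.finRep.smoothPart.toSubmodule : Set ↥P.toSubmodule)) := by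
    have h := image_closure_subset_closure_image (f := fun w : ↥P.toSubmodule => (w : (adelicGroupData F E c N J).L2 μ)) continuous_subtype_val
      (mem_image_of_mem _ (D.dense_finRep_smoothPart ⟨v, hv⟩))
    exact h
  -- every smooth vector lies in some `P ⊓ Fix(Stab ⊓ K₀)`
  have hsub : (fun w : ↥P.toSubmodule => (w : (adelicGroupData F E c N J).L2 μ)) '' (D.finRep.smoothPart.toSubmodule : Set ↥P.toSubmodule) ⊆
      ((⨆ Kf : {Kf : Subgroup (finAdelic F E c N J) // IsOpen (Kf : Set (finAdelic F E c N J)) ∧ Kf ≤ K₀},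
        P.toSubmodule ⊓ ⨅ u : ↥Kf.1, Module.End.eigenspace ((((adelicGroupData F E c N J).rightRegular μ) (finAdelicToAdelic F E c N J (u : finAdelic F E c N J)) :
          (adelicGroupData F E c N J).L2 μ →L[ℂ] (adelicGroupData F E c N J).L2 μ) : (adelicGroupData F E c N J).L2 μ →ₗ[ℂ] (adelicGroupData F E c N J).L2 μ) 1 :
            Submodule ℂ ((adelicGroupData F E c N J).L2 μ)) : Set ((adelicGroupData F E c N J).L2 μ)) := by
    rintro _ ⟨s, hs, rfl⟩
    have hso : IsOpen (D.finRep.stabilizerSubgroup s : Set (finAdelic F E c N J)) := hs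
    let Kf : {Kf : Subgroup (finAdelic F E c N J) // IsOpen (Kf : Set (finAdelic F E c N J)) ∧ Kf ≤ K₀} :=
      ⟨D.finRep.stabilizerSubgroup s ⊓ K₀, hso.inter hK₀, inf_le_right⟩
    refine Submodule.mem_iSup_of_mem Kf (Submodule.mem_inf.2 ⟨s.2, (Submodule.mem_iInf _).2 fun u => ?_⟩)
    rw [Module.End.mem_eigenspace_iff, one_smul]
    have hu : (u : finAdelic F E c N J) ∈ D.finRep.stabilizerSubgroup s := (inf_le_left : D.finRep.stabilizerSubgroup s ⊓ K₀ ≤ _) u.2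
    rw [Representation.mem_stabilizerSubgroup] at hu
    exact congrArg Subtype.val hu
  have hmem := closure_mono hsub hvcl
  rwa [← Submodule.topologicalClosure_coe] at hmem

/-! ## §5 Joint eigenvectors of `ι_f(K′_f)` (trivially) and `ι_∞κ(K)` (by `τ`) are `(Kad(K′_f), ω̃)`-isotypic -/

section GroupK

variable {K : Type*} [Group K] [TopologicalSpace K] (κ : K →* arch F E c N J)

omit [TopologicalSpace K] in
/-- **`P ⊓ Fix K′_f ⊓ Eig τ ≤ P ⊓ Iso(Kad(K′_f), ω̃)`** for every `ω̃ : ↥Kad(K′_f) →* ℂ` with `ω̃(ι_∞κk) = τ k`, `ω̃(ι_f u) = 1` (★ `forall_apply_eq_smul_iff`: closure induction).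
[cite: Knapp1986, VIII §3] [cite: BorelJacquet1979, §4.1] -/
theorem inf_fix_inf_eig_le_iso (P : Submodule ℂ ((adelicGroupData F E c N J).L2 μ)) (Kf : Subgroup (finAdelic F E c N J)) (τ : K →* ℂ)
    (ω : ↥(Subgroup.closure ((Set.range (fun k : K => (archToAdelic F E c N J) (κ k)) ∪ (finAdelicToAdelic F E c N J) '' (Kf : Set (finAdelic F E c N J))) : Set (adelicGroupData F E c N J).Adelic)) →* ℂ)
    (hωarch : ∀ k : K, ω ⟨(archToAdelic F E c N J) (κ k), Subgroup.subset_closure (Or.inl ⟨k, rfl⟩)⟩ = τ k)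
    (hωfin : ∀ (u : finAdelic F E c N J) (hu : u ∈ Kf), ω ⟨(finAdelicToAdelic F E c N J) u, Subgroup.subset_closure (Or.inr ⟨u, hu, rfl⟩)⟩ = 1) :
    P ⊓ (⨅ u : ↥Kf, Module.End.eigenspace ((((adelicGroupData F E c N J).rightRegular μ) (finAdelicToAdelic F E c N J (u : finAdelic F E c N J)) :
        (adelicGroupData F E c N J).L2 μ →L[ℂ] (adelicGroupData F E c N J).L2 μ) : (adelicGroupData F E c N J).L2 μ →ₗ[ℂ] (adelicGroupData F E c N J).L2 μ) 1)
      ⊓ (⨅ k : K, Module.End.eigenspace ((((adelicGroupData F E c N J).rightRegular μ) (archToAdelic F E c N J (κ k)) :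
        (adelicGroupData F E c N J).L2 μ →L[ℂ] (adelicGroupData F E c N J).L2 μ) : (adelicGroupData F E c N J).L2 μ →ₗ[ℂ] (adelicGroupData F E c N J).L2 μ) (τ k)) ≤
    P ⊓ ⨅ x : ↥(Subgroup.closure ((Set.range (fun k : K => (archToAdelic F E c N J) (κ k)) ∪ (finAdelicToAdelic F E c N J) '' (Kf : Set (finAdelic F E c N J))) : Set (adelicGroupData F E c N J).Adelic)),
      Module.End.eigenspace ((((adelicGroupData F E c N J).rightRegular μ)
        ((Subgroup.closure ((Set.range (fun k : K => (archToAdelic F E c N J) (κ k)) ∪ (finAdelicToAdelic F E c N J) '' (Kf : Set (finAdelic F E c N J))) : Set (adelicGroupData F E c N J).Adelic)).subtype x) :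
        (adelicGroupData F E c N J).L2 μ →L[ℂ] (adelicGroupData F E c N J).L2 μ) : (adelicGroupData F E c N J).L2 μ →ₗ[ℂ] (adelicGroupData F E c N J).L2 μ) (ω x) := by
  rintro v ⟨⟨hvP, hvFix⟩, hvEig⟩
  refine Submodule.mem_inf.2 ⟨hvP, (Submodule.mem_iInf _).2 fun x => ?_⟩
  rw [Module.End.mem_eigenspace_iff]
  have key := (forall_apply_eq_smul_iff κ Kf ((adelicGroupData F E c N J).rightRegular μ).toRepresentation τ ω hωarch hωfin v).2
    ⟨fun u hu => ?_, fun k => ?_⟩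
  · exact key x
  · have h := (Submodule.mem_iInf _).1 hvFix ⟨u, hu⟩
    rw [Module.End.mem_eigenspace_iff, one_smul] at h
    exact h
  · have h := (Submodule.mem_iInf _).1 hvEig k
    rw [Module.End.mem_eigenspace_iff] at h
    exact h

/-- **THE `ω̃` OF A `(K′_f, τ)` AND THE ISOTYPIC INCLUSION TOGETHER**: for `κ` injective there is `ω̃ : ↥Kad(K′_f) →* ℂ` with `ω̃(ι_∞κk) = τ k`, `ω̃(ι_f u) = 1` (★ `exists_kTypeCharacter`), and for it
`P ⊓ Fix K′_f ⊓ Eig τ ≤ P ⊓ Iso(Kad(K′_f), ω̃)`. [cite: Knapp1986, VIII §3] [cite: BorelJacquet1979, §4.1] -/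
theorem exists_kTypeCharacter_inf_fix_inf_eig_le_iso (hκ : Function.Injective κ) (P : Submodule ℂ ((adelicGroupData F E c N J).L2 μ)) (Kf : Subgroup (finAdelic F E c N J))
    (τ : K →* ℂ) :
    ∃ ω : ↥(Subgroup.closure ((Set.range (fun k : K => (archToAdelic F E c N J) (κ k)) ∪ (finAdelicToAdelic F E c N J) '' (Kf : Set (finAdelic F E c N J))) : Set (adelicGroupData F E c N J).Adelic)) →* ℂ,
      (∀ k : K, ω ⟨(archToAdelic F E c N J) (κ k), Subgroup.subset_closure (Or.inl ⟨k, rfl⟩)⟩ = τ k) ∧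
      (∀ (u : finAdelic F E c N J) (hu : u ∈ Kf), ω ⟨(finAdelicToAdelic F E c N J) u, Subgroup.subset_closure (Or.inr ⟨u, hu, rfl⟩)⟩ = 1) ∧
      P ⊓ (⨅ u : ↥Kf, Module.End.eigenspace ((((adelicGroupData F E c N J).rightRegular μ) (finAdelicToAdelic F E c N J (u : finAdelic F E c N J)) :
          (adelicGroupData F E c N J).L2 μ →L[ℂ] (adelicGroupData F E c N J).L2 μ) : (adelicGroupData F E c N J).L2 μ →ₗ[ℂ] (adelicGroupData F E c N J).L2 μ) 1)
        ⊓ (⨅ k : K, Module.End.eigenspace ((((adelicGroupData F E c N J).rightRegular μ) (archToAdelic F E c N J (κ k)) :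
          (adelicGroupData F E c N J).L2 μ →L[ℂ] (adelicGroupData F E c N J).L2 μ) : (adelicGroupData F E c N J).L2 μ →ₗ[ℂ] (adelicGroupData F E c N J).L2 μ) (τ k)) ≤
      P ⊓ ⨅ x : ↥(Subgroup.closure ((Set.range (fun k : K => (archToAdelic F E c N J) (κ k)) ∪ (finAdelicToAdelic F E c N J) '' (Kf : Set (finAdelic F E c N J))) : Set (adelicGroupData F E c N J).Adelic)),
        Module.End.eigenspace ((((adelicGroupData F E c N J).rightRegular μ)
          ((Subgroup.closure ((Set.range (fun k : K => (archToAdelic F E c N J) (κ k)) ∪ (finAdelicToAdelic F E c N J) '' (Kf : Set (finAdelic F E c N J))) : Set (adelicGroupData F E c N J).Adelic)).subtype x) :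
          (adelicGroupData F E c N J).L2 μ →L[ℂ] (adelicGroupData F E c N J).L2 μ) : (adelicGroupData F E c N J).L2 μ →ₗ[ℂ] (adelicGroupData F E c N J).L2 μ) (ω x) := by
  obtain ⟨ω, hωarch, hωfin, -⟩ := exists_kTypeCharacter κ Kf hκ τ
  exact ⟨ω, hωarch, hωfin, inf_fix_inf_eig_le_iso μ κ P Kf τ ω hωarch hωfin⟩

end GroupK

section CommGroupK

variable {K : Type*} [CommGroup K] [TopologicalSpace K] [IsTopologicalGroup K] [CompactSpace K] [T2Space K] (κ : K →* arch F E c N J)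

/-! ## §4 (D-arch) at `U(J)`: `P ⊓ Fix K′_f ≤ closure ⨆_{χ ∈ K̂} (P ⊓ Fix K′_f ⊓ Eig χ)` -/

/-- **(D-arch) DISCHARGED**: for a closed subrepresentation `P ≤ L²(G(F)\G(𝔸_F))`, any `K′_f ≤ G(𝔸_{F,f})` and a compact abelian `K` read in `G(F ⊗ ℝ)` by a continuous `κ`,
`P ⊓ Fix K′_f ≤ closure ⨆_{χ ∈ K̂} (P ⊓ Fix K′_f ⊓ Eig χ)`: §2 for the restriction of `R ∘ ι_∞ ∘ κ` (unitary ★ `isUnitary_rightRegular`, strongly continuous ★ `isStronglyContinuous_rightRegular_holds`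
+ ★ `continuous_archToAdelic`) to the closed subspace `P ⊓ Fix K′_f`, `K`-stable because `ι_∞(κk)` and `ι_f(u)` commute (★ `commute_archToAdelic_finAdelicToAdelic`).
[cite: BrockerTomDieck1985, III (5.7)] [cite: BorelJacquet1979, §4.1] -/
theorem inf_fix_le_topologicalClosure_iSup_inf_eig (hκc : Continuous κ) (P : ClosedSubrep ((adelicGroupData F E c N J).rightRegular μ)) (Kf : Subgroup (finAdelic F E c N J)) :
    P.toSubmodule ⊓ (⨅ u : ↥Kf, Module.End.eigenspace ((((adelicGroupData F E c N J).rightRegular μ) (finAdelicToAdelic F E c N J (u : finAdelic F E c N J)) :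
        (adelicGroupData F E c N J).L2 μ →L[ℂ] (adelicGroupData F E c N J).L2 μ) : (adelicGroupData F E c N J).L2 μ →ₗ[ℂ] (adelicGroupData F E c N J).L2 μ) 1) ≤
      (⨆ χ : PontryaginDual K, P.toSubmodule
        ⊓ (⨅ u : ↥Kf, Module.End.eigenspace ((((adelicGroupData F E c N J).rightRegular μ) (finAdelicToAdelic F E c N J (u : finAdelic F E c N J)) :
            (adelicGroupData F E c N J).L2 μ →L[ℂ] (adelicGroupData F E c N J).L2 μ) : (adelicGroupData F E c N J).L2 μ →ₗ[ℂ] (adelicGroupData F E c N J).L2 μ) 1)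
        ⊓ (⨅ k : K, Module.End.eigenspace ((((adelicGroupData F E c N J).rightRegular μ) (archToAdelic F E c N J (κ k)) :
            (adelicGroupData F E c N J).L2 μ →L[ℂ] (adelicGroupData F E c N J).L2 μ) : (adelicGroupData F E c N J).L2 μ →ₗ[ℂ] (adelicGroupData F E c N J).L2 μ) ((χ k : Circle) : ℂ))).topologicalClosure := by
  have hU := (adelicGroupData F E c N J).isUnitary_rightRegular μ
  have hS := (adelicGroupData F E c N J).isStronglyContinuous_rightRegular_holds μ
  refine le_topologicalClosure_iSup_inf_iInf_eigenspace_of_invariant (σ := ((adelicGroupData F E c N J).rightRegular μ).restrict ((archToAdelic F E c N J).comp κ))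
    (fun k => hU _) (fun v => (hS v).comp ((continuous_archToAdelic F E c N J).comp hκc)) _ ?_ ?_
  · -- `P ⊓ Fix K′_f` is closed
    rw [Submodule.coe_inf, Submodule.coe_iInf]
    exact P.isClosed.inter (isClosed_iInter fun u => ContinuousLinearMap.isClosed_eigenspace _ _)
  · -- `P ⊓ Fix K′_f` is `K`-stable: `R(ι_f u) R(ι_∞κk) v = R(ι_∞κk) R(ι_f u) v = R(ι_∞κk) v`
    rintro k v ⟨hvP, hvFix⟩
    refine ⟨P.apply_mem _ hvP, (Submodule.mem_iInf _).2 fun u => Module.End.mem_eigenspace_iff.2 ?_⟩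
    have hu := Module.End.mem_eigenspace_iff.1 ((Submodule.mem_iInf _).1 hvFix u)
    rw [one_smul, ContinuousLinearMap.coe_coe] at hu ⊢
    rw [ContRepresentation.restrict_apply_apply, MonoidHom.coe_comp, Function.comp_apply, ← mul_apply_eq_comp, ← map_mul,
      ← (commute_archToAdelic_finAdelicToAdelic F E c N J (κ k) (u : finAdelic F E c N J)).eq, map_mul, mul_apply_eq_comp, hu]

/-! ## §6 THE (D) LETTER, no letter left -/

/-- **THE DENSITY LETTER (D) OF THE #4′ ASSEMBLY, PAID**: for an irreducible closed `P ≤ L²(G(F)\G(𝔸_F))`, an OPEN `K₀ ≤ G(𝔸_{F,f})` and a compact abelian `K` read in `G(F ⊗ ℝ)` by an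
injective continuous `κ`: `P ≤ closure ⨆_{ℓ = (K′_f, χ, ω̃)} P ⊓ Iso(Kad(K′_f), ω̃)`, `Iso` in the print's bytes `⨅ k : ↥(K' ℓ), eigenspace (R ((K' ℓ).subtype k)) (ω ℓ k)` with
`K' ℓ := Kad(K′_f) = closure(ι_∞κ(K) ∪ ι_f(K′_f))` (`K′_f ≤ K₀` open), `ω ℓ := ω̃` (`ω̃(ι_∞κk) = χ k`, `ω̃(ι_f u) = 1`, `χ ∈ K̂`) — §1 on §3 (D-fin ★), §4 (D-arch ★) and §5.
[cite: BorelJacquet1979, §4.1, §4.6] [cite: BrockerTomDieck1985, III (5.7)] [cite: Knapp1986, VIII §3] [cite: MoeglinWaldspurger1995, I.2.18] -/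
theorem le_topologicalClosure_iSup_inf_iso (P : ClosedSubrep ((adelicGroupData F E c N J).rightRegular μ)) (hP : P.toContRep.IsTopIrreducible)
    (K₀ : Subgroup (finAdelic F E c N J)) (hK₀ : IsOpen (K₀ : Set (finAdelic F E c N J))) (hκ : Function.Injective κ) (hκc : Continuous κ) :
    P.toSubmodule ≤ (⨆ ℓ : (Σ Kf : {Kf : Subgroup (finAdelic F E c N J) // IsOpen (Kf : Set (finAdelic F E c N J)) ∧ Kf ≤ K₀}, Σ χ : PontryaginDual K,
        {ω : ↥(Subgroup.closure ((Set.range (fun k : K => (archToAdelic F E c N J) (κ k)) ∪ (finAdelicToAdelic F E c N J) '' (Kf.1 : Set (finAdelic F E c N J))) : Set (adelicGroupData F E c N J).Adelic)) →* ℂ //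
          (∀ k : K, ω ⟨(archToAdelic F E c N J) (κ k), Subgroup.subset_closure (Or.inl ⟨k, rfl⟩)⟩ = ((χ k : Circle) : ℂ)) ∧
          ∀ (u : finAdelic F E c N J) (hu : u ∈ Kf.1), ω ⟨(finAdelicToAdelic F E c N J) u, Subgroup.subset_closure (Or.inr ⟨u, hu, rfl⟩)⟩ = 1}),
      P.toSubmodule ⊓ ⨅ x : ↥(Subgroup.closure ((Set.range (fun k : K => (archToAdelic F E c N J) (κ k)) ∪ (finAdelicToAdelic F E c N J) '' (ℓ.1.1 : Set (finAdelic F E c N J))) : Set (adelicGroupData F E c N J).Adelic)),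
        Module.End.eigenspace ((((adelicGroupData F E c N J).rightRegular μ)
          ((Subgroup.closure ((Set.range (fun k : K => (archToAdelic F E c N J) (κ k)) ∪ (finAdelicToAdelic F E c N J) '' (ℓ.1.1 : Set (finAdelic F E c N J))) : Set (adelicGroupData F E c N J).Adelic)).subtype x) :
          (adelicGroupData F E c N J).L2 μ →L[ℂ] (adelicGroupData F E c N J).L2 μ) : (adelicGroupData F E c N J).L2 μ →ₗ[ℂ] (adelicGroupData F E c N J).L2 μ) (ℓ.2.2.1 x)).topologicalClosure := by
  refine le_topologicalClosure_iSup_sigma_of_two_steps P.toSubmodule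
    (fun Kf : {Kf : Subgroup (finAdelic F E c N J) // IsOpen (Kf : Set (finAdelic F E c N J)) ∧ Kf ≤ K₀} =>
      P.toSubmodule ⊓ ⨅ u : ↥Kf.1, Module.End.eigenspace ((((adelicGroupData F E c N J).rightRegular μ) (finAdelicToAdelic F E c N J (u : finAdelic F E c N J)) :
        (adelicGroupData F E c N J).L2 μ →L[ℂ] (adelicGroupData F E c N J).L2 μ) : (adelicGroupData F E c N J).L2 μ →ₗ[ℂ] (adelicGroupData F E c N J).L2 μ) 1)
    (fun (Kf : {Kf : Subgroup (finAdelic F E c N J) // IsOpen (Kf : Set (finAdelic F E c N J)) ∧ Kf ≤ K₀}) (χ : PontryaginDual K) =>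
      P.toSubmodule
        ⊓ (⨅ u : ↥Kf.1, Module.End.eigenspace ((((adelicGroupData F E c N J).rightRegular μ) (finAdelicToAdelic F E c N J (u : finAdelic F E c N J)) :
            (adelicGroupData F E c N J).L2 μ →L[ℂ] (adelicGroupData F E c N J).L2 μ) : (adelicGroupData F E c N J).L2 μ →ₗ[ℂ] (adelicGroupData F E c N J).L2 μ) 1)
        ⊓ (⨅ k : K, Module.End.eigenspace ((((adelicGroupData F E c N J).rightRegular μ) (archToAdelic F E c N J (κ k)) :
            (adelicGroupData F E c N J).L2 μ →L[ℂ] (adelicGroupData F E c N J).L2 μ) : (adelicGroupData F E c N J).L2 μ →ₗ[ℂ] (adelicGroupData F E c N J).L2 μ) ((χ k : Circle) : ℂ)))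
    (fun (Kf : {Kf : Subgroup (finAdelic F E c N J) // IsOpen (Kf : Set (finAdelic F E c N J)) ∧ Kf ≤ K₀}) (χ : PontryaginDual K)
        (w : {ω : ↥(Subgroup.closure ((Set.range (fun k : K => (archToAdelic F E c N J) (κ k)) ∪ (finAdelicToAdelic F E c N J) '' (Kf.1 : Set (finAdelic F E c N J))) : Set (adelicGroupData F E c N J).Adelic)) →* ℂ //
          (∀ k : K, ω ⟨(archToAdelic F E c N J) (κ k), Subgroup.subset_closure (Or.inl ⟨k, rfl⟩)⟩ = ((χ k : Circle) : ℂ)) ∧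
          ∀ (u : finAdelic F E c N J) (hu : u ∈ Kf.1), ω ⟨(finAdelicToAdelic F E c N J) u, Subgroup.subset_closure (Or.inr ⟨u, hu, rfl⟩)⟩ = 1}) =>
      P.toSubmodule ⊓ ⨅ x : ↥(Subgroup.closure ((Set.range (fun k : K => (archToAdelic F E c N J) (κ k)) ∪ (finAdelicToAdelic F E c N J) '' (Kf.1 : Set (finAdelic F E c N J))) : Set (adelicGroupData F E c N J).Adelic)),
        Module.End.eigenspace ((((adelicGroupData F E c N J).rightRegular μ)
          ((Subgroup.closure ((Set.range (fun k : K => (archToAdelic F E c N J) (κ k)) ∪ (finAdelicToAdelic F E c N J) '' (Kf.1 : Set (finAdelic F E c N J))) : Set (adelicGroupData F E c N J).Adelic)).subtype x) :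
          (adelicGroupData F E c N J).L2 μ →L[ℂ] (adelicGroupData F E c N J).L2 μ) : (adelicGroupData F E c N J).L2 μ →ₗ[ℂ] (adelicGroupData F E c N J).L2 μ) (w.1 x))
    (le_topologicalClosure_iSup_inf_fix μ P hP K₀ hK₀) (fun Kf => inf_fix_le_topologicalClosure_iSup_inf_eig μ κ hκc P Kf.1) fun Kf χ => ?_
  obtain ⟨ω, hωarch, hωfin, hle⟩ :=
    exists_kTypeCharacter_inf_fix_inf_eig_le_iso μ κ hκ P.toSubmodule Kf.1 (Circle.coeHom.comp (χ : K →ₜ* Circle).toMonoidHom)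
  exact ⟨⟨ω, hωarch, hωfin⟩, hle⟩

/-! ## §7 (ED. 2) THE (D) LETTER over the richer index: `ω̃` unitary and continuous -/

/-- **THE DENSITY LETTER (D), RICHER INDEX (ED. 2)**: the same `hD` as `le_topologicalClosure_iSup_inf_iso`, over `Λ′ := Σ (K′_f ≤ K₀ open) (χ ∈ K̂) {ω̃ : ↥Kad(K′_f) →* ℂ ∣ ω̃(ι_∞κk) = χ k, ω̃(ι_f u) = 1,
‖ω̃‖ = 1, ω̃ continuous}` — the two extra properties are ★ `exists_kTypeCharacter`'s unitarity and continuity clauses (`‖χ k‖ = 1`, `χ` continuous, `K` compact, `κ` continuous), so that the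
consumers of `(K' ℓ, ω ℓ) := (Kad ℓ.1.1, ℓ.2.2.1)` read `Continuous (ω ℓ)` and `‖ω ℓ k‖ = 1` off `ℓ.2.2.2` (e.g. to instantiate ★ `K2E1PseudoEisensteinNiceGeneratorsKTypeU` at `Kc := ↥(K' ℓ)`,
`ι := (K' ℓ).subtype`, `τ := ω ℓ`). [cite: BorelJacquet1979, §4.1, §4.6] [cite: BrockerTomDieck1985, III (5.7)] [cite: Knapp1986, VIII §3] [cite: MoeglinWaldspurger1995, I.2.18] -/
theorem le_topologicalClosure_iSup_inf_iso_of_continuous (P : ClosedSubrep ((adelicGroupData F E c N J).rightRegular μ)) (hP : P.toContRep.IsTopIrreducible)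
    (K₀ : Subgroup (finAdelic F E c N J)) (hK₀ : IsOpen (K₀ : Set (finAdelic F E c N J))) (hκ : Function.Injective κ) (hκc : Continuous κ) :
    P.toSubmodule ≤ (⨆ ℓ : (Σ Kf : {Kf : Subgroup (finAdelic F E c N J) // IsOpen (Kf : Set (finAdelic F E c N J)) ∧ Kf ≤ K₀}, Σ χ : PontryaginDual K,
        {ω : ↥(Subgroup.closure ((Set.range (fun k : K => (archToAdelic F E c N J) (κ k)) ∪ (finAdelicToAdelic F E c N J) '' (Kf.1 : Set (finAdelic F E c N J))) : Set (adelicGroupData F E c N J).Adelic)) →* ℂ //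
          (∀ k : K, ω ⟨(archToAdelic F E c N J) (κ k), Subgroup.subset_closure (Or.inl ⟨k, rfl⟩)⟩ = ((χ k : Circle) : ℂ)) ∧
          (∀ (u : finAdelic F E c N J) (hu : u ∈ Kf.1), ω ⟨(finAdelicToAdelic F E c N J) u, Subgroup.subset_closure (Or.inr ⟨u, hu, rfl⟩)⟩ = 1) ∧
          (∀ x, ‖ω x‖ = 1) ∧ Continuous ω}),
      P.toSubmodule ⊓ ⨅ x : ↥(Subgroup.closure ((Set.range (fun k : K => (archToAdelic F E c N J) (κ k)) ∪ (finAdelicToAdelic F E c N J) '' (ℓ.1.1 : Set (finAdelic F E c N J))) : Set (adelicGroupData F E c N J).Adelic)),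
        Module.End.eigenspace ((((adelicGroupData F E c N J).rightRegular μ)
          ((Subgroup.closure ((Set.range (fun k : K => (archToAdelic F E c N J) (κ k)) ∪ (finAdelicToAdelic F E c N J) '' (ℓ.1.1 : Set (finAdelic F E c N J))) : Set (adelicGroupData F E c N J).Adelic)).subtype x) :
          (adelicGroupData F E c N J).L2 μ →L[ℂ] (adelicGroupData F E c N J).L2 μ) : (adelicGroupData F E c N J).L2 μ →ₗ[ℂ] (adelicGroupData F E c N J).L2 μ) (ℓ.2.2.1 x)).topologicalClosure := by
  refine le_topologicalClosure_iSup_sigma_of_two_steps P.toSubmodule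
    (fun Kf : {Kf : Subgroup (finAdelic F E c N J) // IsOpen (Kf : Set (finAdelic F E c N J)) ∧ Kf ≤ K₀} =>
      P.toSubmodule ⊓ ⨅ u : ↥Kf.1, Module.End.eigenspace ((((adelicGroupData F E c N J).rightRegular μ) (finAdelicToAdelic F E c N J (u : finAdelic F E c N J)) :
        (adelicGroupData F E c N J).L2 μ →L[ℂ] (adelicGroupData F E c N J).L2 μ) : (adelicGroupData F E c N J).L2 μ →ₗ[ℂ] (adelicGroupData F E c N J).L2 μ) 1)
    (fun (Kf : {Kf : Subgroup (finAdelic F E c N J) // IsOpen (Kf : Set (finAdelic F E c N J)) ∧ Kf ≤ K₀}) (χ : PontryaginDual K) =>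
      P.toSubmodule
        ⊓ (⨅ u : ↥Kf.1, Module.End.eigenspace ((((adelicGroupData F E c N J).rightRegular μ) (finAdelicToAdelic F E c N J (u : finAdelic F E c N J)) :
            (adelicGroupData F E c N J).L2 μ →L[ℂ] (adelicGroupData F E c N J).L2 μ) : (adelicGroupData F E c N J).L2 μ →ₗ[ℂ] (adelicGroupData F E c N J).L2 μ) 1)
        ⊓ (⨅ k : K, Module.End.eigenspace ((((adelicGroupData F E c N J).rightRegular μ) (archToAdelic F E c N J (κ k)) :
            (adelicGroupData F E c N J).L2 μ →L[ℂ] (adelicGroupData F E c N J).L2 μ) : (adelicGroupData F E c N J).L2 μ →ₗ[ℂ] (adelicGroupData F E c N J).L2 μ) ((χ k : Circle) : ℂ)))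
    (fun (Kf : {Kf : Subgroup (finAdelic F E c N J) // IsOpen (Kf : Set (finAdelic F E c N J)) ∧ Kf ≤ K₀}) (χ : PontryaginDual K)
        (w : {ω : ↥(Subgroup.closure ((Set.range (fun k : K => (archToAdelic F E c N J) (κ k)) ∪ (finAdelicToAdelic F E c N J) '' (Kf.1 : Set (finAdelic F E c N J))) : Set (adelicGroupData F E c N J).Adelic)) →* ℂ //
          (∀ k : K, ω ⟨(archToAdelic F E c N J) (κ k), Subgroup.subset_closure (Or.inl ⟨k, rfl⟩)⟩ = ((χ k : Circle) : ℂ)) ∧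
          (∀ (u : finAdelic F E c N J) (hu : u ∈ Kf.1), ω ⟨(finAdelicToAdelic F E c N J) u, Subgroup.subset_closure (Or.inr ⟨u, hu, rfl⟩)⟩ = 1) ∧
          (∀ x, ‖ω x‖ = 1) ∧ Continuous ω}) =>
      P.toSubmodule ⊓ ⨅ x : ↥(Subgroup.closure ((Set.range (fun k : K => (archToAdelic F E c N J) (κ k)) ∪ (finAdelicToAdelic F E c N J) '' (Kf.1 : Set (finAdelic F E c N J))) : Set (adelicGroupData F E c N J).Adelic)),
        Module.End.eigenspace ((((adelicGroupData F E c N J).rightRegular μ)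
          ((Subgroup.closure ((Set.range (fun k : K => (archToAdelic F E c N J) (κ k)) ∪ (finAdelicToAdelic F E c N J) '' (Kf.1 : Set (finAdelic F E c N J))) : Set (adelicGroupData F E c N J).Adelic)).subtype x) :
          (adelicGroupData F E c N J).L2 μ →L[ℂ] (adelicGroupData F E c N J).L2 μ) : (adelicGroupData F E c N J).L2 μ →ₗ[ℂ] (adelicGroupData F E c N J).L2 μ) (w.1 x))
    (le_topologicalClosure_iSup_inf_fix μ P hP K₀ hK₀) (fun Kf => inf_fix_le_topologicalClosure_iSup_inf_eig μ κ hκc P Kf.1) fun Kf χ => ?_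
  obtain ⟨ω, hωarch, hωfin, -, hωnorm, hωcont⟩ := exists_kTypeCharacter κ Kf.1 hκ (Circle.coeHom.comp (χ : K →ₜ* Circle).toMonoidHom)
  have hτnorm : ∀ k : K, ‖(Circle.coeHom.comp (χ : K →ₜ* Circle).toMonoidHom) k‖ = 1 := fun k => Circle.norm_coe (χ k)
  have hτcont : Continuous (Circle.coeHom.comp (χ : K →ₜ* Circle).toMonoidHom) := continuous_subtype_val.comp (map_continuous χ)
  exact ⟨⟨ω, hωarch, hωfin, hωnorm hτnorm, hωcont inferInstance inferInstance hκc hτcont⟩,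
    inf_fix_inf_eig_le_iso μ κ P.toSubmodule Kf.1 (Circle.coeHom.comp (χ : K →ₜ* Circle).toMonoidHom) ω hωarch hωfin⟩

end CommGroupK

end Adelic

end Summit.HodgeConjecture.HodgeConjecture.R90.S8

end
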